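import Summits.QuantumFields.YangMills.Theorems.PencilRigidityDiagonalMirrorRPRCentreReduction
import Summits.QuantumFields.YangMills.Theorems.PencilRigidityDiagonalMirrorRPRStubRpClosureTwisted

/-!
# Crux `DiagonalMirrorRPR` (stmt-QuantumFields-10604), line `centre-twisted-swap`: the provable content of the line, CLOSED

Plugging the landed S4'' `CentreTwistedSwap.stub_rpClosureTwisted` (`…StubRpClosureTwisted`) into the landed reduction of the line
(`…CentreReduction`, where S1' `CentreTwistedSwap.stub_twistedSwapRP` is already discharged):

* `Reduction.stub_restatedCruxCentre_holds` — UNCONDITIONAL: for every compact simple `G`, `r`, `sch`, `S₁`, the curvature package `W₁`, the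
  WEAKENED sign clause `(∃ z ∈ Subgroup.center G, r.ρ z = -1) ∨ ∀ᶠ k in atTop, 0 ≤ sch.β k` and convergence of the renormalised
  curvature strings to `S₁` on `⁰𝒮` along the 45° covers (`tiltedLatticeSchwinger`) imply `DiagonalFrameRP S₁` — the planners'
  restated crux (`ParityBridgeColdTraces.Reduction.restatedCrux_holds`) with its sign clause weakened at zero cost downstream.
* `Reduction.stub_crux_of_transport` — the crux (the item's recorded decl) from the two cover-transport statements
  T (`stub_coverTransportOffDiag`), T_c (`stub_coverTransportCentre`) and the scope statement N' (`stub_centreBlindNegativeScope`)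
  ALONE: everything else in the line `centre-twisted-swap` is proved.

Do not import `…CentreTwistedReduction` together with `…CentreReduction` (the former is the farm-independent twin of the latter,
same namespace; this file uses the latter).  The binder-shape (`MeasurableSpace G := borel G`) and `PencilRigidity`-copy forms are the
landed `restatedCruxCentre_of_rpClosureTwisted` / `DiagonalMirrorRPR_of_transport` applied to `stub_rpClosureTwisted` (not restated here).  References: Fröhlich–Israel–Lieb–Simon, Comm. Math. Phys. 62 (1978) Thm 2.1;
Osterwalder–Schrader, Comm. Math. Phys. 31 (1973) §2–3; Osterwalder–Seiler, Ann. Phys. 110 (1978) §2; 't Hooft, Nucl. Phys. B153 (1979).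
-/

set_option autoImplicit false

noncomputable section

open scoped SchwartzMap
open MeasureTheory Filter Topology
open Literature.MathematicalPhysics.QuantumLattice Literature.MathematicalPhysics.AQFT
  Literature.MathematicalPhysics.QuantumFieldTheory

namespace Summit.QuantumFields.YangMills.Cruxes.DiagonalMirrorRPR.CentreTwistedSwap.Reduction

open ParityBridgeColdTraces

/-- **Registered sub-goal `stub_restatedCruxCentre_holds` — the restated crux with the weakened sign clause holds** (unconditional):
for every compact simple `G`, `r`, `sch`, `S₁`, the curvature package `W₁`, the sign clause
`(∃ z ∈ Subgroup.center G, r.ρ z = -1) ∨ ∀ᶠ k in atTop, 0 ≤ sch.β k` and convergence of the renormalised curvature strings to `S₁` on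
`⁰𝒮` along the 45° covers imply reflection positivity of `S₁` in pull-back form in the four diagonal frames. -/
theorem stub_restatedCruxCentre_holds : ∀ (G : Type) [Group G] [TopologicalSpace G] [IsTopologicalGroup G] [CompactSpace G] [MeasurableSpace G] [BorelSpace G], IsCompactSimpleLieGroup G → ∀ (r : LatticeRep G) (sch : SpeciesScheme (YMSpecies G)) (S₁ : SchwingerFamily E4), CurvaturePackage r sch S₁ → ((∃ z ∈ Subgroup.center G, r.ρ z = -1) ∨ ∀ᶠ k in atTop, 0 ≤ sch.β k) → (∀ (n : ℕ), n ≠ 0 → ∀ (f : Fin n → 𝓢(E4, ℝ)) (F : 𝓢((Fin n → E4), ℂ)), IsTensorOf F (fun i => ofRealTest (f i)) → IsOffDiagonal F → Tendsto (fun k : ℕ => ((tiltedLatticeSchwinger r.ρ sch (fun s => s.F) k n (fun _ => r.curvature) f : ℝ) : ℂ)) atTop (𝓝 (S₁ n F))) → DiagonalFrameRP S₁ :=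
  stub_restatedCruxCentre_closes stub_rpClosureTwisted

/-- **Registered sub-goal `stub_crux_of_transport` — the crux from transport + scope ALONE** (S1', S4'' discharged): the two
cover-transport statements T, T_c and the scope statement N' imply `DiagonalMirrorRPR` (the item's recorded decl, the
`MirrorModularBoosts` copy, shared verbatim with the `PencilRigidity` copy). -/
theorem stub_crux_of_transport : (∀ (G : Type) [Group G] [TopologicalSpace G] [IsTopologicalGroup G] [CompactSpace G] [MeasurableSpace G] [BorelSpace G], IsCompactSimpleLieGroup G → ∀ (r : LatticeRep G) (sch : SpeciesScheme (YMSpecies G)) (S₁ : SchwingerFamily E4), CurvaturePackage r sch S₁ → (∀ᶠ k in atTop, 0 ≤ sch.β k) → CoverInsensitivityOffDiag r sch) → (∀ (G : Type) [Group G] [TopologicalSpace G] [IsTopologicalGroup G] [CompactSpace G] [MeasurableSpace G] [BorelSpace G], IsCompactSimpleLieGroup G → ∀ (r : LatticeRep G) (sch : SpeciesScheme (YMSpecies G)) (S₁ : SchwingerFamily E4), CurvaturePackage r sch S₁ → (∃ z ∈ Subgroup.center G, r.ρ z = -1) → CoverInsensitivityOffDiag r sch) → (∀ (G : Type) [Group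 G] [TopologicalSpace G] [IsTopologicalGroup G] [CompactSpace G] [MeasurableSpace G] [BorelSpace G], IsCompactSimpleLieGroup G → ∀ (r : LatticeRep G) (sch : SpeciesScheme (YMSpecies G)) (S₁ : SchwingerFamily E4), CurvaturePackage r sch S₁ → (¬ ∃ z ∈ Subgroup.center G, r.ρ z = -1) → (∃ᶠ k in atTop, sch.β k < 0) → DiagonalFrameRP S₁) → Summit.QuantumFields.YangMills.Theses.MirrorModularBoosts.DiagonalMirrorRPR :=
  stub_centreReduction_transport stub_rpClosureTwisted

end Summit.QuantumFields.YangMills.Cruxes.DiagonalMirrorRPR.CentreTwistedSwap.Reduction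

end
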